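import Literature.MathematicalPhysics.QuantumFieldTheory.ConformalBootstrap3D.PointKernelK34v2Data
import Literature.MathematicalPhysics.QuantumFieldTheory.ConformalBootstrap3D.PointKernelParts

/-!
# K34v2 certificate, kernel part file P21: one-cell head segments 141, 142 in level ranges

The head cells whose kernel evaluation exceeds one `decide` are one-cell segments of `hsegsK34v2`; each is
checked by `PCert.hPartSideOK` (side conditions) and `PCert.hPartOK` per level range `[n_lo, n_lo + count)`
against an integer claim, the claims summing to `≥ 0` (`PointKernel.partsOK`); soundness is
`PCert.hParts_sound` (`PointKernelParts`).  The part files `P1, P2, …` are mutually independent (each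
imports only the data file); the ranges of one cell may span several of them, and the per-cell
conclusions `hparts_i` / `hcell_i` of those cells are assembled in `PointKernelK34v2.lean`.
Estimated kernel time 241 s.
-/

set_option maxRecDepth 100000
set_option maxHeartbeats 0

namespace Literature.MathematicalPhysics.QuantumFieldTheory.ConformalBootstrap3D.PointKernelK34v2

open Literature.MathematicalPhysics.QuantumFieldTheory.ConformalBootstrap3D.PointKernel

/-- levels `[60, 64)` of segment 141: partial lower sum `≥` claim. [folklore] -/
theorem part_141_6 : certK34v2.hPartOK (PCert.segAt hsegsK34v2 141) JHK34v2 60 4 (405458193756604542094379662026097186) = true := by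
  decide +kernel

/-- levels `[64, 68)` of segment 141: partial lower sum `≥` claim. [folklore] -/
theorem part_141_7 : certK34v2.hPartOK (PCert.segAt hsegsK34v2 141) JHK34v2 64 4 (252256365212639993468884789631261039) = true := by
  decide +kernel

/-- levels `[68, 71)` of segment 141: partial lower sum `≥` claim. [folklore] -/
theorem part_141_8 : certK34v2.hPartOK (PCert.segAt hsegsK34v2 141) JHK34v2 68 3 (117861863727716807956845443579674360) = true := by
  decide +kernel

/-- levels `[71, 73)` of segment 141: partial lower sum `≥` claim. [folklore] -/
theorem part_141_9 : certK34v2.hPartOK (PCert.segAt hsegsK34v2 141) JHK34v2 71 2 (49707169347303019683417235911412551) = true := by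
  decide +kernel

/-- one-cell segment 142 (row 6, cell `[28675/4096, 7169/1024]`, chord, `n_F = 72`,
10 level ranges): side conditions. [folklore] -/
theorem pside_142 : certK34v2.hPartSideOK (PCert.segAt hsegsK34v2 142) JHK34v2 = true := by
  decide +kernel

/-- its level ranges `(n_lo, count, claim)`. [folklore] -/
def parts_142 : List (ℕ × ℕ × ℤ) := [(0, 25, -43160433428755657049560666139668988143), (25, 11, 27494108657480516860393829216879815132), (36, 8, 9197775516836100257631374398302036068), (44, 6, 3314840382402151449922440611511652505), (50, 5, 1502153912292606136447361150901100052), (55, 5, 854128423265709957268379385833007990), (60, 4, 398525850503863853855353899036371474), (64, 4, 245299619786324116163344219197066913), (68, 3, 110883423270581941598670367051447305), (71, 2, 42717642917802476279912890956490706)]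

/-- the ranges tile `[0, n_F]` and the claims sum to `≥ 0`. [folklore] -/
theorem pcov_142 : PointKernel.partsOK 72 parts_142 = true := by
  decide +kernel

end Literature.MathematicalPhysics.QuantumFieldTheory.ConformalBootstrap3D.PointKernelK34v2
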